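import Literature.AlgebraicGeometry.Morphisms.ProjectiveMorphism
import Literature.AlgebraicGeometry.Morphisms.ProjectiveSpaceOverBasePoints
import Mathlib.AlgebraicGeometry.IdealSheaf.Functorial
import Literature.AlgebraicGeometry.Modules.VanishingLocusIntersection
import Mathlib.AlgebraicGeometry.Morphisms.Flat
import Mathlib.AlgebraicGeometry.Noetherian
import HarnessLib

/-!
# The piece `M_Q ⊂ V_Q ⊂ HS_Q` of the Hom-scheme: the closed locus «family inside `W`», the open locus «family ≅ `Y`» — the LOCUS

Layer `Literature/AlgebraicGeometry/Motives`, namespace `Literature.AlgebraicGeometry.Motives`.  Theorems only: no definition, no named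
fact, no instance, no notation, no `sorry`.  Universe `0`.

[MumfordFogartyKirwan1994] Ch. 0 §5 (c) (p. 23) ∕ [FGA] 221 §4.c: `Hom_S(Y, X)` is the open subscheme «graphs» of
`Hilb((Y ×_S X)∕S)`; per Hilbert polynomial `Q`, `M_Q ⊂ V_Q ⊂ HS_Q` with `HS_Q` the Hilbert scheme of `Q` in `𝐏(ι)` over `S`, `V_Q` the
CLOSED locus where the universal family lies inside `W = Y ×_S X ↪ 𝐏(ι; S)`, and `M_Q ⊂ V_Q` the OPEN locus where it projects
isomorphically onto `Y`.  This file performs that construction from the three LAYERS of the child line `F4IIbHomScheme` taken as DATA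
and HYPOTHESES (no sorried stub is imported): the Hilbert layer (`HS`, `h`, universal family `iH : ZH ↪ 𝐏(ι; HS)`), the closed layer
(an ideal sheaf `V` on `HS` with its functor of points `hV`), and the open-layer principle `hB3` (B-p09 (g17)'s iso-locus shape):

* **`exists_homSchemePieceLocus`** — there are: the closed subscheme `cV : V' ↪ HS` of `V` (locally Noetherian), the family
  `iV : Z_V ↪ 𝐏(ι; V')` (closed, flat, the base change of `iH`: a cartesian square), its FACTORISATION `wZ : Z_V → Y ×_S X` through `W`
  (`wZ ≫ jW = iV ≫ 𝐏(cV ≫ h)`, Mathlib `IsClosedImmersion.lift` on the kernel containment that `hV` grants at `w := cV`), the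
  projection `g : Z_V → Y_{V'} = Y ×_S V'` over `V'` (Mathlib `pullback.lift`), and an OPEN `U ⊆ V'` such that a morphism `b : T → V'`
  lands in `U` iff the base change `g_T` is an isomorphism (`hB3` at `f := Z_V → V'` proper flat, `q′ := Y_{V'} → V'`); together with
  the functor of points of `V'` («`w : T → HS` factors through `cV` iff the family pulled back along `w` lies inside `W`»: `hV` + ★ L5
  `Modules.exists_comp_subschemeι_iff_le_ker`).

The piece is `M_Q := U` with `c := U.ι ≫ cV` (a monomorphism); its universal morphism, self-letters and universality are the files
`HomSchemePiece{Data,Univ}` (stubs (B4a)∕(B4b) of `F4IIbHomScheme`).  Cell hodgecm-mathlib, F-4 (II-b), B-p14 (g20) MAIN on (B4a).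
Count-neutral capital: HC_CM is proved only modulo the 7 printed citations until rung 0 closes; nothing here bears on it.

## References

* D. Mumford, J. Fogarty, F. Kirwan, *Geometric Invariant Theory* (3rd ed., 1994), Ch. 0 §5 (c) (p. 23). [MumfordFogartyKirwan1994]
* U. Görtz, T. Wedhorn, *Algebraic Geometry I* (2nd ed., 2020), Proposition 14.28 (p. 438) and Section (4.12). [GortzWedhorn2020]
* The Stacks Project, Tag 01NF. [StacksProject]
-/

noncomputable section

set_option backward.isDefEq.respectTransparency false

open CategoryTheory CategoryTheory.Limits AlgebraicGeometry
open Literature.AlgebraicGeometry Literature.AlgebraicGeometry.Morphisms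

namespace Literature.AlgebraicGeometry.Motives

/-- `𝐏(ι; -)` is functorial (without `[Finite ι]`): `𝐏(a ≫ b) = 𝐏(a) ≫ 𝐏(b)`. [cite: StacksProject, Tag 01NF] -/
private theorem projectiveSpaceMap_comp₃ (ι : Type) {S T T' : Scheme.{0}} (a : T' ⟶ T) (b : T ⟶ S) :
    Morphisms.projectiveSpaceMap ι (a ≫ b) = Morphisms.projectiveSpaceMap ι a ≫ Morphisms.projectiveSpaceMap ι b := by
  apply pullback.hom_ext
  · rw [Morphisms.projectiveSpaceMap_fst, Category.assoc, Morphisms.projectiveSpaceMap_fst,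
      Morphisms.projectiveSpaceMap_fst_assoc]
  · rw [Morphisms.projectiveSpaceMap_snd, Category.assoc, Morphisms.projectiveSpaceMap_snd, Morphisms.projectiveSpaceMap_snd]

/-- **THE LOCUS `U ⊂ V' ↪ HS` of the Hom-scheme piece** (see the module doc-string): construction of the closed subscheme `V'`, the
family `Z_V ↪ 𝐏(ι; V')` with its factorisation through `W = Y ×_S X`, the projection `g : Z_V → Y_{V'}`, and the open iso-locus `U`,
with the two functors of points.  Inputs: the Hilbert layer as data, the closed layer `(V, hV)`, the open-layer principle `hB3`.
[cite: MumfordFogartyKirwan1994, Ch. 0 §5 (c) (p. 23)] [cite: GortzWedhorn2020, Proposition 14.28 (p. 438)] -/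
theorem exists_homSchemePieceLocus {S Y X : Scheme.{0}} [IsLocallyNoetherian S] (q : Y ⟶ S) (p : X ⟶ S)
    (hq : IsProjective q) {ι : Type}
    (jW : pullback q p ⟶ Morphisms.projectiveSpace ι S) [IsClosedImmersion jW]
    (hjW : jW ≫ Morphisms.projectiveSpaceFst ι S = pullback.fst q p ≫ q)
    -- the Hilbert layer, as data
    {HS : Scheme.{0}} [IsLocallyNoetherian HS] (h : HS ⟶ S) {ZH : Scheme.{0}} (iH : ZH ⟶ Morphisms.projectiveSpace ι HS)
    [IsClosedImmersion iH] [Flat (iH ≫ Morphisms.projectiveSpaceFst ι HS)]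
    -- the closed layer
    (V : HS.IdealSheafData)
    (hV : ∀ ⦃T : Scheme.{0}⦄ [IsLocallyNoetherian T] (w : T ⟶ HS),
      V ≤ w.ker ↔
        (pullback.snd jW (Morphisms.projectiveSpaceMap ι h)).ker.comap (Morphisms.projectiveSpaceMap ι w) ≤
          iH.ker.comap (Morphisms.projectiveSpaceMap ι w))
    -- the open-layer principle
    (hB3 : ∀ ⦃V Γ Y' : Scheme.{0}⦄ (f : Γ ⟶ V) (q' : Y' ⟶ V) (g : Γ ⟶ Y') (hg : g ≫ q' = f)
      [IsProper f] [Flat f] [IsSeparated q'] [UniversallyClosed q'] [IsLocallyNoetherian Y'],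
      ∃ U : V.Opens, ∀ ⦃T : Scheme.{0}⦄ (b : T ⟶ V),
        IsIso (pullback.map f b q' b g (𝟙 T) (𝟙 V) (by rw [Category.comp_id, hg]) (by rw [Category.comp_id, Category.id_comp])) ↔
          Set.range b.base ⊆ (U : Set V)) :
    ∃ (V' : Scheme.{0}) (cV : V' ⟶ HS) (_ : IsClosedImmersion cV) (_ : IsLocallyNoetherian V')
      (ZV : Scheme.{0}) (iV : ZV ⟶ Morphisms.projectiveSpace ι V') (_ : IsClosedImmersion iV) (gZ : ZV ⟶ ZH)
      (_ : IsPullback iV gZ (Morphisms.projectiveSpaceMap ι cV) iH) (_ : Flat (iV ≫ Morphisms.projectiveSpaceFst ι V'))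
      (_ : IsProper (iV ≫ Morphisms.projectiveSpaceFst ι V'))
      (wZ : ZV ⟶ pullback q p) (_ : wZ ≫ jW = iV ≫ Morphisms.projectiveSpaceMap ι (cV ≫ h))
      (g : ZV ⟶ pullback q (cV ≫ h)) (_ : g ≫ pullback.fst q (cV ≫ h) = wZ ≫ pullback.fst q p)
      (hg₂ : g ≫ pullback.snd q (cV ≫ h) = iV ≫ Morphisms.projectiveSpaceFst ι V') (U : V'.Opens),
      -- functor of points of the closed locus
      (∀ ⦃T : Scheme.{0}⦄ [IsLocallyNoetherian T] (w : T ⟶ HS),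
        (∃ w' : T ⟶ V', w' ≫ cV = w) ↔
          (pullback.snd jW (Morphisms.projectiveSpaceMap ι h)).ker.comap (Morphisms.projectiveSpaceMap ι w) ≤
            iH.ker.comap (Morphisms.projectiveSpaceMap ι w)) ∧
      -- functor of points of the open locus
      ∀ ⦃T : Scheme.{0}⦄ (b : T ⟶ V'),
        IsIso (pullback.map (iV ≫ Morphisms.projectiveSpaceFst ι V') b (pullback.snd q (cV ≫ h)) b g (𝟙 T) (𝟙 V')
          (by rw [Category.comp_id, hg₂]) (by rw [Category.comp_id, Category.id_comp])) ↔
          Set.range b.base ⊆ (U : Set V') := by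
  haveI : IsProper q := hq.isProper
  -- the closed subscheme `V'` of `V`
  let V' : Scheme.{0} := V.subscheme
  let cV : V' ⟶ HS := V.subschemeι
  haveI : IsLocallyNoetherian V' := LocallyOfFiniteType.isLocallyNoetherian cV
  have hVc : V ≤ cV.ker := (Scheme.IdealSheafData.ker_subschemeι V).ge
  -- functor of points of `V'`
  have hfp : ∀ ⦃T : Scheme.{0}⦄ [IsLocallyNoetherian T] (w : T ⟶ HS), (∃ w' : T ⟶ V', w' ≫ cV = w) ↔
      (pullback.snd jW (Morphisms.projectiveSpaceMap ι h)).ker.comap (Morphisms.projectiveSpaceMap ι w) ≤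
        iH.ker.comap (Morphisms.projectiveSpaceMap ι w) := fun T _ w => by
    rw [← hV w]
    exact Modules.exists_comp_subschemeι_iff_le_ker w V
  -- the family over `V'` and the ideal of `W` over `V'`
  let ZV : Scheme.{0} := pullback (Morphisms.projectiveSpaceMap ι cV) iH
  let iV : ZV ⟶ Morphisms.projectiveSpace ι V' := pullback.fst _ _
  let gZ : ZV ⟶ ZH := pullback.snd _ _
  have HZ : IsPullback iV gZ (Morphisms.projectiveSpaceMap ι cV) iH := IsPullback.of_hasPullback _ _
  haveI : Flat (iV ≫ Morphisms.projectiveSpaceFst ι V') :=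
    MorphismProperty.of_isPullback (HZ.flip.paste_vert (Morphisms.isPullback_projectiveSpaceMap ι cV)) inferInstance
  let iWH : pullback jW (Morphisms.projectiveSpaceMap ι h) ⟶ Morphisms.projectiveSpace ι HS := pullback.snd _ _
  let WV : Scheme.{0} := pullback (Morphisms.projectiveSpaceMap ι cV) iWH
  let iWV : WV ⟶ Morphisms.projectiveSpace ι V' := pullback.fst _ _
  -- kernel containment over `V'` (the closed layer at `w := cV`) and the factorisation through `W`
  have hK : iWV.ker ≤ iV.ker := by
    rw [Scheme.IdealSheafData.ker_fst_of_isClosedImmersion, Scheme.IdealSheafData.ker_fst_of_isClosedImmersion]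
    exact (hV cV).mp hVc
  let γ : ZV ⟶ WV := IsClosedImmersion.lift iWV iV hK
  have hγ : γ ≫ iWV = iV := IsClosedImmersion.lift_fac _ _ _
  let wZ : ZV ⟶ pullback q p := γ ≫ pullback.snd _ _ ≫ pullback.fst _ _
  have hwZ : wZ ≫ jW = iV ≫ Morphisms.projectiveSpaceMap ι (cV ≫ h) := by
    change ((γ ≫ pullback.snd _ _) ≫ pullback.fst _ _) ≫ jW = _
    rw [Category.assoc, pullback.condition, ← Category.assoc, Category.assoc γ, ← pullback.condition, ← Category.assoc, hγ,
      Category.assoc, ← projectiveSpaceMap_comp₃]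
  -- the projection `g : Z_V → Y ×_S V'`
  have hgw : (wZ ≫ pullback.fst q p) ≫ q = (iV ≫ Morphisms.projectiveSpaceFst ι V') ≫ (cV ≫ h) := by
    rw [Category.assoc, ← hjW, ← Category.assoc, hwZ, Category.assoc, Morphisms.projectiveSpaceMap_fst, Category.assoc]
  let g : ZV ⟶ pullback q (cV ≫ h) := pullback.lift (wZ ≫ pullback.fst q p) (iV ≫ Morphisms.projectiveSpaceFst ι V') hgw
  have hg₁ : g ≫ pullback.fst q (cV ≫ h) = wZ ≫ pullback.fst q p := pullback.lift_fst _ _ _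
  have hg₂ : g ≫ pullback.snd q (cV ≫ h) = iV ≫ Morphisms.projectiveSpaceFst ι V' := pullback.lift_snd _ _ _
  -- hypotheses of the open-layer principle
  haveI : IsProper (iV ≫ Morphisms.projectiveSpaceFst ι V') := inferInstance
  haveI : IsSeparated (pullback.snd q (cV ≫ h)) := MorphismProperty.pullback_snd _ _ inferInstance
  haveI : UniversallyClosed (pullback.snd q (cV ≫ h)) := MorphismProperty.pullback_snd _ _ inferInstance
  haveI : LocallyOfFiniteType (pullback.snd q (cV ≫ h)) := MorphismProperty.pullback_snd _ _ inferInstance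
  haveI : IsLocallyNoetherian (pullback q (cV ≫ h)) := LocallyOfFiniteType.isLocallyNoetherian (pullback.snd q (cV ≫ h))
  obtain ⟨U, hU⟩ := hB3 (iV ≫ Morphisms.projectiveSpaceFst ι V') (pullback.snd q (cV ≫ h)) g hg₂
  exact ⟨V', cV, inferInstance, inferInstance, ZV, iV, inferInstance, gZ, HZ, inferInstance, inferInstance, wZ, hwZ, g, hg₁, hg₂, U,
    hfp, hU⟩

end Literature.AlgebraicGeometry.Motives

end
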